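import Literature.InformationTheory.QuantumCodes.ClusterCountingBound
import Mathlib.Analysis.SpecificLimits.Basic
import Mathlib.Order.ConditionallyCompleteLattice.Basic
import HarnessLib

/-!
# Independent (code-capacity) bit-flip noise on a finite set of locations; the accuracy threshold

Topic `Literature/InformationTheory/QuantumCodes` (venture QEC, LADDER-QEC rung Q5, PARTITION row 09;
column word for every declaration below: DEFINITION, as printed — this file holds the PUBLISHED
definitions only; their elementary API (normalisation, union bound, monotonicity, `p_c ≤ 1`, …) is
proved in `Summits/Ventures/QEC/Thresholds/Threshold.lean`, and nothing here is a numerical claim).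

The error model of Dennis–Kitaev–Landahl–Preskill 2002, §4.1 and §4.4, for ONE type of error
(bit flips, or phase flips — "we have separate procedures for recovery from the X errors and the
Z errors", §4.1) with perfect syndrome measurement (`q = 0`): a finite set of locations `ι`
(links of the lattice = qubits), "errors arise independently on each link with probability `p`"
(§4.4), so that an error chain `E ⊆ ι` occurs with probability
`prob(E) = ∏_ℓ (1 - p)^{1 - n_E(ℓ)} p^{n_E(ℓ)}` (§4.4, eq. (prob_E)), i.e. `p^{|E|} (1-p)^{|ι|-|E|}`
— the tree's `bernoulliWeight` (`ClusterCountingBound.lean`, Fawzi–Grospellier–Leverrier's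
"independent noise", REUSED here). The version with arbitrary per-location rates (`indepWeight`) covers the
phenomenological model of §4.1–4.2 (qubit errors with probability `p` on space-like links,
measurement errors with probability `q` on time-like links of the space-time lattice). The
probability of a decidable event `P ⊆ 2^ι` — e.g. "recovery fails on `E`" — is the finite sum
`eventProb P p = Σ_{E ∈ P} prob(E)` (real-valued, computable in principle; no measure theory is
needed on a finite sample space).

The ACCURACY THRESHOLD (§4.3): "the probability of error per qubit lies below the accuracy
threshold if and only if the recovery procedure fails with a probability that vanishes as the
linear size `L` of the lattice increases to infinity" — `BelowThreshold P p` for a family of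
failure probabilities `P : ℕ → ℝ → ℝ` (size index, error rate). A number `p₀` is a LOWER BOUND ON
THE THRESHOLD (the form in which §5.3 states its results: "the accuracy threshold is surely
attained provided that `p < …`") when every `0 ≤ p < p₀` is below threshold
(`IsThresholdLowerBound`), and `accuracyThreshold P` is the supremum of such `p₀ ≤ 1`. "Below
threshold the failure probability decreases exponentially with `L`" (§5.3, after eq. (fail_iso))
is `DecaysExponentially`.

Design notes. (1) The source defines "below threshold" pointwise in `p`; it does not prove that
the set of such `p` is an interval for an arbitrary recovery procedure, so the threshold VALUE is
rendered as the supremum of the `p₀` whose whole interval `[0, p₀)` is below threshold (for a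
family whose failure probability is monotone in `p` the two readings agree); the cap `p₀ ≤ 1`
only makes the supremum finite (`0` is always a lower bound, so the set is non-empty).
(2) "Vanishes as `L → ∞`" is `Filter.Tendsto … atTop (𝓝 0)`; for the non-negative sequences that
occur this is the same as `limsup = 0`. (3) Families are indexed by `ℕ`; a family that only makes
sense for `L ≥ 1` is indexed by `L ↦ L + 1` at the point of use.

Deliberately NOT here: the lemma API (Summits side, see above); Pauli-valued (depolarising)
noise as a `PMF` and the logical failure probability of a stabilizer code + decoder
(`Summits/Ventures/QEC/Thresholds/Noise.lean`, `…/Threshold.lean`); the toric code and the DKLP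
counting bound (`ToricCodeThreshold.lean`); threshold theorems for fault-tolerant circuits
(`ThresholdTheorems.lean`); any Monte Carlo number.

## References (read)

* [DennisEtAl2002] E. Dennis, A. Kitaev, A. Landahl, J. Preskill, *Topological quantum memory*,
  J. Math. Phys. 43 (2002) 4452–4505, arXiv:quant-ph/0110143 (held `paper:arxiv-quant-ph_0110143`):
  §4.1 (the error model), §4.3 (accuracy threshold, definition before eq. (ec_cond)), §4.4
  (eq. (prob_E)), §4.6 (`p_c`), §5.3 (threshold lower bounds; exponential decay below threshold).
-/

namespace Literature.InformationTheory.QuantumCodes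

open Finset Filter Topology

/-! ### Independent bit-flip noise on a finite set of locations -/

section Weight

variable {ι : Type*} [Fintype ι]

/-- Independent, not identically distributed errors: location `i` is in error with probability
`r i` — "errors on horizontal links occur with probability `p`, and errors on vertical links occur
with probability `q`" (the phenomenological model; the tree's `bernoulliWeight p` is the
constant-rate case).
[cite: DennisEtAl2002, §4.2 (error history: probability p on horizontal, q on vertical links)] -/
def indepWeight [DecidableEq ι] (r : ι → ℝ) (E : Finset ι) : ℝ :=
  (∏ i ∈ E, r i) * ∏ i ∈ univ \ E, (1 - r i)

/-- The probability `Σ_{E : P E} prob(E)` of a decidable event `P` on error chains under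
independent bit-flip noise of rate `p`; for `P E` = "recovery fails on `E`" this is the failure
probability `Σ_E prob(E) · 𝟙[failure]` whose vanishing defines the threshold.
[cite: DennisEtAl2002, §4.3 eq. (ec_cond)] -/
def eventProb (P : Finset ι → Prop) [DecidablePred P] (p : ℝ) : ℝ :=
  ∑ E ∈ univ.filter P, bernoulliWeight p E

/-- The locations of a space-time **error history** with `T` rounds of syndrome measurement:
qubit-error locations `(qubit, round)` ("horizontal links", probability `p`) and
measurement-error locations `(check, round)` ("vertical links", probability `q`) — "We will
repeat the syndrome measurement `T` times in succession, and the 'error history' can be described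
as a set of marked links on a lattice with altogether `T` time slices".
[cite: DennisEtAl2002, §4.2 (error history with T time slices)] -/
abbrev HistoryLoc (Q C : Type*) (T : ℕ) : Type _ := (Q × Fin T) ⊕ (C × Fin T)

/-- The per-location rates of the **phenomenological noise model**: `p` on qubit-error locations,
`q` on measurement-error locations. [cite: DennisEtAl2002, §4.2 (probability p on horizontal, q on vertical links)] -/
def phenomRate {Q C : Type*} {T : ℕ} (p q : ℝ) : HistoryLoc Q C T → ℝ :=
  Sum.elim (fun _ => p) (fun _ => q)

/-- The probability of an error history `E` (a set of faulty space-time locations) in the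
phenomenological model with `T` rounds: independent faults, rate `p` at qubit locations and `q`
at measurement locations — `(p/(1-p))^H (q/(1-q))^V` up to normalisation for `H` qubit and `V`
measurement faults. [cite: DennisEtAl2002, §5.1 eq. (HV_prob) (with §4.2)] -/
def phenomenologicalWeight {Q C : Type*} [Fintype Q] [Fintype C] [DecidableEq Q] [DecidableEq C]
    (T : ℕ) (p q : ℝ) (E : Finset (HistoryLoc Q C T)) : ℝ :=
  indepWeight (phenomRate p q) E

end Weight

/-! ### The accuracy threshold -/

section Threshold

variable (P : ℕ → ℝ → ℝ)

/-- **Below threshold** (Dennis–Kitaev–Landahl–Preskill): for a family of failure probabilities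
`P L p` (size index `L`, error rate `p`), the rate `p` lies below the accuracy threshold iff
"the recovery procedure fails with a probability that vanishes as the linear size `L` of the
lattice increases to infinity". [cite: DennisEtAl2002, §4.3 (definition preceding eq. (ec_cond))] -/
def BelowThreshold (p : ℝ) : Prop :=
  Tendsto (fun L => P L p) atTop (𝓝 0)

/-- `p₀` is a **lower bound on the accuracy threshold**: every rate `0 ≤ p < p₀` is below
threshold ("Numerically, the accuracy threshold is surely attained provided that … `p, q < .0114`";
"the threshold value of `p` can be relaxed to at least `.0373`").
[cite: DennisEtAl2002, §5.3 (eqs. (threshold_iso_num), (threshold_2d))] -/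
def IsThresholdLowerBound (p₀ : ℝ) : Prop :=
  ∀ p : ℝ, 0 ≤ p → p < p₀ → BelowThreshold P p

/-- The set of threshold lower bounds `≤ 1` (plumbing for `accuracyThreshold`; the cap only makes
the supremum finite). [folklore] -/
def thresholdLowerBounds : Set ℝ :=
  {p₀ | p₀ ≤ 1 ∧ IsThresholdLowerBound P p₀}

/-- The **accuracy threshold** `p_c` of the family `P` ("What accuracy threshold can be achieved
by surface codes? … `p_c`"): the supremum of its threshold lower bounds `p₀ ≤ 1`, i.e. the largest
`p_c` such that every `0 ≤ p < p_c` is below threshold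
(`Summit.Ventures.QEC.Thresholds.isThresholdLowerBound_accuracyThreshold`).
[cite: DennisEtAl2002, §4.3 and §4.6 (accuracy threshold p_c)] -/
noncomputable def accuracyThreshold : ℝ :=
  sSup (thresholdLowerBounds P)

/-- **Exponential decay below threshold**: `|P L p| ≤ C r^L` for some `C` and `0 ≤ r < 1`
("Not only does eq. (fail_iso) establish a lower bound on the accuracy threshold; it also shows
that, below threshold, the failure probability decreases exponentially with `L`").
[cite: DennisEtAl2002, §5.3 (after eq. (fail_iso))] -/
def DecaysExponentially (p : ℝ) : Prop :=
  ∃ C r : ℝ, 0 ≤ r ∧ r < 1 ∧ ∀ L : ℕ, |P L p| ≤ C * r ^ L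

end Threshold

/-! ### Elementary API of the independent noise model (appended 2026-08-26, qec-type-09)

The facts below are the routine probability bookkeeping that Dennis et al. use without comment in
§4.3–§5.3 (normalisation of `prob(E)`, monotonicity and the union bound "we can now bound the
probability that `E + E_min` contains any connected path … by counting such paths", complements)
and the order-theoretic consequences of the threshold definition; all PROVED. -/

section WeightAPI

variable {ι : Type*} [Fintype ι]

/-- Normalisation of the independent model: `Σ_E ∏_{i ∈ E} rᵢ ∏_{i ∉ E} (1 - rᵢ) = ∏ᵢ (rᵢ + (1 - rᵢ)) = 1`.
[cite: DennisEtAl2002, §4.4 eq. (prob_E) (prob(E) is a probability distribution)] -/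
theorem sum_indepWeight [DecidableEq ι] (r : ι → ℝ) : ∑ E : Finset ι, indepWeight r E = 1 := by
  have h := Finset.prod_add (fun i => r i) (fun i => 1 - r i) (Finset.univ : Finset ι)
  simp only [add_sub_cancel, Finset.prod_const_one, Finset.powerset_univ] at h
  exact h.symm

/-- The independent weight is non-negative for rates in `[0, 1]`.
[cite: DennisEtAl2002, §4.4 eq. (prob_E)] -/
theorem indepWeight_nonneg [DecidableEq ι] {r : ι → ℝ} (h₀ : ∀ i, 0 ≤ r i) (h₁ : ∀ i, r i ≤ 1)
    (E : Finset ι) : 0 ≤ indepWeight r E :=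
  mul_nonneg (prod_nonneg fun i _ => h₀ i) (prod_nonneg fun i _ => sub_nonneg.2 (h₁ i))

/-- The i.i.d. weight is the independent weight with constant rate: `p^{|E|}(1-p)^{|ι|-|E|} =
∏_{i ∈ E} p ∏_{i ∉ E} (1 - p)`. [cite: DennisEtAl2002, §4.4 eq. (prob_E)] -/
theorem bernoulliWeight_eq_indepWeight [DecidableEq ι] (p : ℝ) (E : Finset ι) :
    bernoulliWeight p E = indepWeight (fun _ => p) E := by
  simp only [bernoulliWeight, indepWeight, prod_const, card_univ_sdiff]

/-- `eventProb` as a sum with an indicator. [cite: DennisEtAl2002, §4.3 eq. (ec_cond)] -/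
theorem eventProb_eq_sum_ite (P : Finset ι → Prop) [DecidablePred P] (p : ℝ) :
    eventProb P p = ∑ E : Finset ι, if P E then bernoulliWeight p E else 0 := by
  rw [eventProb, sum_filter]

/-- Event probabilities are non-negative (`0 ≤ p ≤ 1`). [cite: DennisEtAl2002, §4.3 eq. (ec_cond)] -/
theorem eventProb_nonneg (P : Finset ι → Prop) [DecidablePred P] {p : ℝ} (hp₀ : 0 ≤ p)
    (hp₁ : p ≤ 1) : 0 ≤ eventProb P p :=
  sum_nonneg fun E _ => bernoulliWeight_nonneg hp₀ hp₁ E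

/-- The sure event has probability `1` (normalisation `Σ_E prob(E) = 1`).
[cite: DennisEtAl2002, §4.4 eq. (prob_E)] -/
theorem eventProb_true (p : ℝ) : eventProb (fun _ : Finset ι => True) p = 1 := by
  simp [eventProb, sum_bernoulliWeight]

/-- The impossible event has probability `0`. [cite: DennisEtAl2002, §4.3 eq. (ec_cond)] -/
theorem eventProb_false (p : ℝ) : eventProb (fun _ : Finset ι => False) p = 0 := by
  simp [eventProb]

/-- Monotonicity: `P ⊆ Q ⟹ Prob(P) ≤ Prob(Q)` (`0 ≤ p ≤ 1`) — e.g. "failure ⟹ `E + E_min`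
contains a non-trivial self-avoiding polygon" bounds the failure probability by that of the larger
event. [cite: DennisEtAl2002, §5.2 (Prob_fail ≤ Σ Prob_SAP, eq. (saw_L))] -/
theorem eventProb_mono {P Q : Finset ι → Prop} [DecidablePred P] [DecidablePred Q]
    (h : ∀ E, P E → Q E) {p : ℝ} (hp₀ : 0 ≤ p) (hp₁ : p ≤ 1) : eventProb P p ≤ eventProb Q p :=
  sum_le_sum_of_subset_of_nonneg
    (fun E hE => by
      simp only [mem_filter, mem_univ, true_and] at hE ⊢
      exact h E hE)
    fun E _ _ => bernoulliWeight_nonneg hp₀ hp₁ E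

/-- Event probabilities are at most `1` (`0 ≤ p ≤ 1`). [cite: DennisEtAl2002, §4.4 eq. (prob_E)] -/
theorem eventProb_le_one (P : Finset ι → Prop) [DecidablePred P] {p : ℝ} (hp₀ : 0 ≤ p)
    (hp₁ : p ≤ 1) : eventProb P p ≤ 1 :=
  (eventProb_mono (Q := fun _ => True) (fun _ _ => trivial) hp₀ hp₁).trans (eventProb_true p).le

/-- Complement rule `Prob(¬P) = 1 - Prob(P)` (success vs failure of recovery).
[cite: DennisEtAl2002, §4.3 (recovery succeeds … and fails otherwise)] -/
theorem eventProb_not (P : Finset ι → Prop) [DecidablePred P] (p : ℝ) :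
    eventProb (fun E => ¬P E) p = 1 - eventProb P p := by
  rw [eq_sub_iff_add_eq, add_comm, eventProb, eventProb, sum_filter_add_sum_filter_not,
    sum_bernoulliWeight]

/-- Union bound `Prob(P ∨ Q) ≤ Prob(P) + Prob(Q)` (`0 ≤ p ≤ 1`).
[cite: DennisEtAl2002, §5.2 (before eq. (saw_prob): bounding by counting paths)] -/
theorem eventProb_or_le (P Q : Finset ι → Prop) [DecidablePred P] [DecidablePred Q] {p : ℝ}
    (hp₀ : 0 ≤ p) (hp₁ : p ≤ 1) :
    eventProb (fun E => P E ∨ Q E) p ≤ eventProb P p + eventProb Q p := by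
  classical
  have hPQ : (univ.filter fun E => P E ∨ Q E) = univ.filter P ∪ univ.filter Q := filter_or _ _ _
  rw [eventProb, eventProb, eventProb, hPQ, ← sum_union_inter]
  exact le_add_of_nonneg_right (sum_nonneg fun E _ => bernoulliWeight_nonneg hp₀ hp₁ E)

/-- Finite union bound `Prob(∃ a ∈ s, P a) ≤ Σ_{a ∈ s} Prob(P a)` (`0 ≤ p ≤ 1`) — "we can now bound
the probability that `E + E_min` contains any connected path … by counting such paths".
[cite: DennisEtAl2002, §5.2 (before eq. (saw_prob))] -/
theorem eventProb_exists_le_sum {α : Type*} [DecidableEq α] (s : Finset α)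
    (P : α → Finset ι → Prop) [∀ a, DecidablePred (P a)] {p : ℝ} (hp₀ : 0 ≤ p) (hp₁ : p ≤ 1) :
    eventProb (fun E => ∃ a ∈ s, P a E) p ≤ ∑ a ∈ s, eventProb (P a) p := by
  classical
  induction s using Finset.induction_on with
  | empty => simp [eventProb]
  | insert a s ha ih =>
    rw [sum_insert ha]
    calc eventProb (fun E => ∃ b ∈ insert a s, P b E) p
        = eventProb (fun E => P a E ∨ ∃ b ∈ s, P b E) p := by
          unfold eventProb
          congr 1
          exact filter_congr fun E _ => by simp [Finset.mem_insert, or_and_right, exists_or]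
      _ ≤ eventProb (P a) p + eventProb (fun E => ∃ b ∈ s, P b E) p :=
          eventProb_or_le _ _ hp₀ hp₁
      _ ≤ eventProb (P a) p + ∑ b ∈ s, eventProb (P b) p := by gcongr

end WeightAPI

section ThresholdAPI

variable {P : ℕ → ℝ → ℝ}

/-- A smaller number is again a threshold lower bound. [cite: DennisEtAl2002, §5.3 (threshold attained provided p < …)] -/
theorem IsThresholdLowerBound.anti {p₀ p₁ : ℝ} (h : IsThresholdLowerBound P p₀) (h₁ : p₁ ≤ p₀) :
    IsThresholdLowerBound P p₁ :=
  fun p hp hp' => h p hp (hp'.trans_le h₁)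

/-- Non-positive numbers are threshold lower bounds vacuously. [cite: DennisEtAl2002, §4.3 (definition)] -/
theorem isThresholdLowerBound_of_nonpos {p₀ : ℝ} (h : p₀ ≤ 0) : IsThresholdLowerBound P p₀ :=
  fun _ hp hp' => absurd (hp.trans_lt hp') (not_lt.2 h)

variable (P)

/-- `0` is a threshold lower bound, so the set of lower bounds is non-empty.
[cite: DennisEtAl2002, §4.3 (definition)] -/
theorem thresholdLowerBounds_nonempty : (thresholdLowerBounds P).Nonempty :=
  ⟨0, zero_le_one, isThresholdLowerBound_of_nonpos le_rfl⟩

/-- The set of (capped) lower bounds is bounded above by `1`. [cite: DennisEtAl2002, §4.3 (definition)] -/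
theorem thresholdLowerBounds_bddAbove : BddAbove (thresholdLowerBounds P) :=
  ⟨1, fun _ h => h.1⟩

/-- `p_c ≤ 1`. [cite: DennisEtAl2002, §4.6 (p_c)] -/
theorem accuracyThreshold_le_one : accuracyThreshold P ≤ 1 :=
  csSup_le (thresholdLowerBounds_nonempty P) fun _ h => h.1

/-- `0 ≤ p_c`. [cite: DennisEtAl2002, §4.6 (p_c)] -/
theorem accuracyThreshold_nonneg : 0 ≤ accuracyThreshold P :=
  le_csSup (thresholdLowerBounds_bddAbove P) ⟨zero_le_one, isThresholdLowerBound_of_nonpos le_rfl⟩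

variable {P}

/-- A proved threshold lower bound `p₀ ≤ 1` bounds the accuracy threshold from below — the shape
of every "threshold `≥ p₀`" theorem ("establish a lower bound on the accuracy threshold").
[cite: DennisEtAl2002, §5.3 (after eq. (fail_iso))] -/
theorem le_accuracyThreshold {p₀ : ℝ} (h : IsThresholdLowerBound P p₀) (h₁ : p₀ ≤ 1) :
    p₀ ≤ accuracyThreshold P :=
  le_csSup (thresholdLowerBounds_bddAbove P) ⟨h₁, h⟩

/-- Every rate `0 ≤ p < p_c` is below threshold. [cite: DennisEtAl2002, §4.3 and §4.6] -/
theorem belowThreshold_of_lt_accuracyThreshold {p : ℝ} (hp : 0 ≤ p)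
    (h : p < accuracyThreshold P) : BelowThreshold P p := by
  obtain ⟨p₀, hp₀, hlt⟩ := exists_lt_of_lt_csSup (thresholdLowerBounds_nonempty P) h
  exact hp₀.2 p hp hlt

variable (P)

/-- `p_c` is itself a threshold lower bound (the supremum is attained in this sense).
[cite: DennisEtAl2002, §4.3 and §4.6] -/
theorem isThresholdLowerBound_accuracyThreshold :
    IsThresholdLowerBound P (accuracyThreshold P) :=
  fun _ hp h => belowThreshold_of_lt_accuracyThreshold hp h

variable {P}

/-- Exponential decay implies vanishing, i.e. below threshold ("the failure probability decreases
exponentially with `L`" ⟹ "vanishes as `L → ∞`"). [cite: DennisEtAl2002, §5.3 (after eq. (fail_iso))] -/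
theorem DecaysExponentially.belowThreshold {p : ℝ} (h : DecaysExponentially P p) :
    BelowThreshold P p := by
  obtain ⟨C, r, hr₀, hr₁, hb⟩ := h
  have hg : Tendsto (fun L : ℕ => C * r ^ L) atTop (𝓝 0) := by
    simpa using (tendsto_pow_atTop_nhds_zero_of_lt_one hr₀ hr₁).const_mul C
  have hg' : Tendsto (fun L : ℕ => -(C * r ^ L)) atTop (𝓝 0) := by
    simpa using hg.neg
  exact tendsto_of_tendsto_of_tendsto_of_le_of_le hg' hg (fun L => (abs_le.1 (hb L)).1)
    fun L => (abs_le.1 (hb L)).2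

/-- A family dominated by a below-threshold family is below threshold (comparison of a failure
probability with an upper BOUND for it, as in eq. (saw_L) ⟹ threshold).
[cite: DennisEtAl2002, §5.3 (eq. (saw_L) rapidly approaches zero)] -/
theorem BelowThreshold.of_le {Q : ℕ → ℝ → ℝ} {p : ℝ} (hQ : BelowThreshold Q p)
    (h₀ : ∀ L, 0 ≤ P L p) (h : ∀ L, P L p ≤ Q L p) : BelowThreshold P p :=
  squeeze_zero h₀ h hQ

end ThresholdAPI

end Literature.InformationTheory.QuantumCodes
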